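import Mathlib
import Summits.Ventures.PercRepro2.Defs
import Summits.Ventures.PercRepro2.Graph
import Summits.Ventures.PercRepro2.OneColourSwitch
import Summits.Ventures.PercRepro2.RegionHubSign
import Summits.Ventures.PercRepro2.SideSwitch
import Summits.Ventures.PercRepro2.TermSwitchDefs
import Summits.Ventures.PercRepro2.TermSwitchFibre
import Summits.Ventures.PercRepro2.TermSwitchCompsFibre
import Summits.Ventures.PercRepro2.TermSwitchMono
import Summits.Ventures.PercRepro2.TermSwitchM9
import Summits.Ventures.PercRepro2.M9NoPocketDefs
import Summits.Ventures.PercRepro2.M9DAvoid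
import Summits.Ventures.PercRepro2.M9DAvoidSplit
import Summits.Ventures.PercRepro2.M9RegionSplit
import Summits.Ventures.PercRepro2.M9PocketCubeWorldMono
import Summits.Ventures.PercRepro2.M9SingleDPocket

/-!
# The dead-end partition of the single-`d` sum (blind cell PercRepro2, p3 g23, 2026-08-28;
`proofs/P3-HARRIS.md` §10)

Without the adjacency hypothesis (i), the hub-free region of the `d`-avoiding sum is larger than
the `sepH ∧ DZeroH` set of the terminal set `{r, s, d}`: it also contains the colourings with a
**dead end** — a vertex of the `Y`-world of `{r, s}` that is `W`-connected to `d` while `d` has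
no `W`-source (`deadW`), or the mirror (`deadY`).  With edges `d–r` and `d–s` the `Sep ∧ DOne`
colourings split into three parts: the **A-region** `regA` (`d ∉ M₂`, no `Y`-hub, and a `W`-hub
or a `W`-dead end), its mirror `regB`, and the rest, which is exactly `sepH ∧ DZeroH`
(`sep2_dOne_iff_sepH_dzeroH_of_not_reg`).  On `regA` every `T`-edge is `Y`, so `r ~_Y s` and
`r ~_W s` is the `G − d` connection: `σ_rs = 1 − 1[r ~_W s in G − d]` (`sigma_rs_of_regA`).
Hence `dSignSumAvoid = regionA − regionB + dzeroSignSumH {r, s, d}` (`dSignSumAvoid_eq_dead`)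
with `regionB = −regionA` (`regionB_eq_neg_regionA`), so `T1 = 2·regionA + dzeroSignSumH`.
Own work; std axioms.
-/

namespace Summit.Ventures.PercRepro2

namespace NoPocket

open Finset Classical RegionHub OneColourSwitch SideSwitch TermSwitch

variable {V : Type*} {E : Type*}

section Dead

variable (ends : E → Sym2 V)

/-- A `W`-dead end of `d`: a vertex other than `r, s, d` of the `Y`-world of `{r, s}` that is
`W`-connected to `d`. -/
def deadW (d r s : V) (ω : Config E) : Prop :=
  ∃ v, v ≠ r ∧ v ≠ s ∧ v ≠ d ∧ v ∈ K2 ends r s ω ∧ Conn ends (OneColourSwitch.compl ω) d v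

/-- A `Y`-dead end of `d` (the mirror of `deadW`). -/
def deadY (d r s : V) (ω : Config E) : Prop := deadW ends d r s (OneColourSwitch.compl ω)

/-- The A-region: `d ∉ M₂`, no `Y`-hub edge, and a `W`-hub edge or a `W`-dead end. -/
def regA (p q r s d : V) (ω : Config E) : Prop :=
  d ∉ M2 ends r s ω ∧ ¬ hubY ends d p q ω ∧ (hubW ends d p q ω ∨ deadW ends d r s ω)

/-- The B-region: the mirror of the A-region. -/
def regB (p q r s d : V) (ω : Config E) : Prop := regA ends p q r s d (OneColourSwitch.compl ω)

variable {ends}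

/-- `deadY` unfolded. -/
lemma deadY_iff {d r s : V} {ω : Config E} :
    deadY ends d r s ω ↔ ∃ v, v ≠ r ∧ v ≠ s ∧ v ≠ d ∧ v ∈ M2 ends r s ω ∧ Conn ends ω d v := by
  simp only [deadY, deadW, K2_compl, compl_compl]

/-- `deadW` of the flipped colouring is `deadY`. -/
lemma deadW_compl {d r s : V} (ω : Config E) :
    deadW ends d r s (OneColourSwitch.compl ω) ↔ deadY ends d r s ω := Iff.rfl

/-- `deadY` of the flipped colouring is `deadW`. -/
lemma deadY_compl {d r s : V} (ω : Config E) :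
    deadY ends d r s (OneColourSwitch.compl ω) ↔ deadW ends d r s ω := by
  simp only [deadY, compl_compl]

/-- `regB` unfolded. -/
lemma regB_iff {p q r s d : V} {ω : Config E} :
    regB ends p q r s d ω ↔
      d ∉ K2 ends r s ω ∧ ¬ hubW ends d p q ω ∧ (hubY ends d p q ω ∨ deadY ends d r s ω) := by
  simp only [regB, regA, M2_compl, hubW, compl_compl, deadW_compl]

/-- `regA` of the flipped colouring is `regB`. -/
lemma regA_compl {p q r s d : V} (ω : Config E) :
    regA ends p q r s d (OneColourSwitch.compl ω) ↔ regB ends p q r s d ω := Iff.rfl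

/-- `regB` of the flipped colouring is `regA`. -/
lemma regB_compl {p q r s d : V} (ω : Config E) :
    regB ends p q r s d (OneColourSwitch.compl ω) ↔ regA ends p q r s d ω := by
  simp only [regB, compl_compl]

/-- With an edge `d–r`, `d` lies in a world of `{r, s}`. -/
lemma mem_K2_or_mem_M2 {d r s : V} (ω : Config E) {er : E} (her : ends er = s(d, r)) :
    d ∈ K2 ends r s ω ∨ d ∈ M2 ends r s ω := by
  by_cases h : d ∈ M2 ends r s ω
  · exact Or.inr h
  · exact Or.inl (mem_K2_iff.2 (Or.inl (conn_symm (conn_of_edge_of_not_mem_M2 h (Or.inl rfl) her))))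

/-- The A- and B-regions are disjoint (an edge `d–r`). -/
lemma not_regA_and_regB {p q r s d : V} {ω : Config E} {er : E} (her : ends er = s(d, r)) :
    ¬ (regA ends p q r s d ω ∧ regB ends p q r s d ω) := by
  rintro ⟨⟨hM, _, _⟩, hB⟩
  obtain ⟨hK, _, _⟩ := regB_iff.1 hB
  rcases mem_K2_or_mem_M2 ω her with h | h
  · exact hK h
  · exact hM h

/-- **Outside the A- and B-regions, a `Sep ∧ DOne` colouring is hub-free.** -/
lemma hubfree_of_not_reg {p q r s d : V} {ω : Config E} (hsep : sep2 ends p q r s ω)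
    {er : E} (her : ends er = s(d, r)) (hA : ¬ regA ends p q r s d ω)
    (hB : ¬ regB ends p q r s d ω) : ¬ hubY ends d p q ω ∧ ¬ hubW ends d p q ω := by
  rcases mem_K2_or_mem_M2 ω her with hK | hM
  · -- `d ∈ K₂`: no `Y`-hub; if `d ∉ M₂` the A-region excludes a `W`-hub, else `d ∈ M₂` does
    have hY : ¬ hubY ends d p q ω := fun h => not_mem_K2_of_hubY hsep h hK
    refine ⟨hY, fun hW => ?_⟩
    by_cases hM : d ∈ M2 ends r s ω
    · exact not_mem_M2_of_hubW hsep hW hM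
    · exact hA ⟨hM, hY, Or.inl hW⟩
  · have hW : ¬ hubW ends d p q ω := fun h => not_mem_M2_of_hubW hsep h hM
    refine ⟨fun hY => ?_, hW⟩
    by_cases hK : d ∈ K2 ends r s ω
    · exact not_mem_K2_of_hubY hsep hY hK
    · exact hB (regB_iff.2 ⟨hK, hW, Or.inl hY⟩)

/-- **The partition**: a `Sep ∧ DOne` colouring outside the A- and B-regions is `sepH ∧ DZeroH`
for `{r, s, d}`, and conversely. -/
theorem sep2_dOne_iff_sepH_dzeroH_of_not_reg {p q r s d : V} (hpd : p ≠ d) (hqd : q ≠ d)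
    {ω : Config E} {er : E} (her : ends er = s(d, r)) :
    (sep2 ends p q r s ω ∧ DOne ends r s d ω ∧ ¬ regA ends p q r s d ω ∧
        ¬ regB ends p q r s d ω) ↔
      (sepH ends p q ({r, s, d} : Set V) ω ∧ DZeroH ends ({r, s, d} : Set V) ω) := by
  constructor
  · rintro ⟨hsep, hD, hA, hB⟩
    obtain ⟨hY, hW⟩ := hubfree_of_not_reg hsep her hA hB
    have hH := sepH_of_hubfree hpd hqd hsep hY hW
    refine ⟨hH, ?_⟩
    intro v hv hvK hvM
    simp only [Set.mem_insert_iff, Set.mem_singleton_iff, not_or] at hv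
    obtain ⟨hvr, hvs, hvd⟩ := hv
    rcases mem_KH_triple.1 hvK with h1 | h1 | h1 <;> rcases mem_MH_triple.1 hvM with h2 | h2 | h2
    · exact hD v hvr hvs hvd (mem_K2_iff.2 (Or.inl h1)) (mem_M2_iff.2 (Or.inl h2))
    · exact hD v hvr hvs hvd (mem_K2_iff.2 (Or.inl h1)) (mem_M2_iff.2 (Or.inr h2))
    · -- `v ∈ K₂`, `d ~_W v`
      by_cases hM : d ∈ M2 ends r s ω
      · exact hD v hvr hvs hvd (mem_K2_iff.2 (Or.inl h1)) (by
          rcases mem_M2_iff.1 hM with h | h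
          · exact mem_M2_iff.2 (Or.inl (conn_trans h h2))
          · exact mem_M2_iff.2 (Or.inr (conn_trans h h2)))
      · exact hA ⟨hM, hY, Or.inr ⟨v, hvr, hvs, hvd, mem_K2_iff.2 (Or.inl h1), h2⟩⟩
    · exact hD v hvr hvs hvd (mem_K2_iff.2 (Or.inr h1)) (mem_M2_iff.2 (Or.inl h2))
    · exact hD v hvr hvs hvd (mem_K2_iff.2 (Or.inr h1)) (mem_M2_iff.2 (Or.inr h2))
    · by_cases hM : d ∈ M2 ends r s ω
      · exact hD v hvr hvs hvd (mem_K2_iff.2 (Or.inr h1)) (by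
          rcases mem_M2_iff.1 hM with h | h
          · exact mem_M2_iff.2 (Or.inl (conn_trans h h2))
          · exact mem_M2_iff.2 (Or.inr (conn_trans h h2)))
      · exact hA ⟨hM, hY, Or.inr ⟨v, hvr, hvs, hvd, mem_K2_iff.2 (Or.inr h1), h2⟩⟩
    · -- `d ~_Y v`, `v ∈ M₂`
      by_cases hK : d ∈ K2 ends r s ω
      · exact hD v hvr hvs hvd (by
          rcases mem_K2_iff.1 hK with h | h
          · exact mem_K2_iff.2 (Or.inl (conn_trans h h1))
          · exact mem_K2_iff.2 (Or.inr (conn_trans h h1))) (mem_M2_iff.2 (Or.inl h2))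
      · exact hB (regB_iff.2 ⟨hK, hW, Or.inr (deadY_iff.2 ⟨v, hvr, hvs, hvd, mem_M2_iff.2 (Or.inl h2), h1⟩)⟩)
    · by_cases hK : d ∈ K2 ends r s ω
      · exact hD v hvr hvs hvd (by
          rcases mem_K2_iff.1 hK with h | h
          · exact mem_K2_iff.2 (Or.inl (conn_trans h h1))
          · exact mem_K2_iff.2 (Or.inr (conn_trans h h1))) (mem_M2_iff.2 (Or.inr h2))
      · exact hB (regB_iff.2 ⟨hK, hW, Or.inr (deadY_iff.2 ⟨v, hvr, hvs, hvd, mem_M2_iff.2 (Or.inr h2), h1⟩)⟩)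
    · -- `d ~_Y v` and `d ~_W v`: `d` lies in a world, which then contains `v`
      rcases mem_K2_or_mem_M2 ω her with hK | hM
      · have hvK2 : v ∈ K2 ends r s ω := by
          rcases mem_K2_iff.1 hK with h | h
          · exact mem_K2_iff.2 (Or.inl (conn_trans h h1))
          · exact mem_K2_iff.2 (Or.inr (conn_trans h h1))
        by_cases hM : d ∈ M2 ends r s ω
        · exact hD v hvr hvs hvd hvK2 (by
            rcases mem_M2_iff.1 hM with h | h
            · exact mem_M2_iff.2 (Or.inl (conn_trans h h2))
            · exact mem_M2_iff.2 (Or.inr (conn_trans h h2)))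
        · exact hA ⟨hM, hY, Or.inr ⟨v, hvr, hvs, hvd, hvK2, h2⟩⟩
      · have hvM2 : v ∈ M2 ends r s ω := by
          rcases mem_M2_iff.1 hM with h | h
          · exact mem_M2_iff.2 (Or.inl (conn_trans h h2))
          · exact mem_M2_iff.2 (Or.inr (conn_trans h h2))
        by_cases hK : d ∈ K2 ends r s ω
        · exact hD v hvr hvs hvd (by
            rcases mem_K2_iff.1 hK with h | h
            · exact mem_K2_iff.2 (Or.inl (conn_trans h h1))
            · exact mem_K2_iff.2 (Or.inr (conn_trans h h1))) hvM2
        · exact hB (regB_iff.2 ⟨hK, hW, Or.inr (deadY_iff.2 ⟨v, hvr, hvs, hvd, hvM2, h1⟩)⟩)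
  · rintro ⟨hH, hDZ⟩
    have hsep : sep2 ends p q r s ω := sep2_of_sepH (by simp) (by simp) hH
    obtain ⟨hpK, hqK, hpM, hqM⟩ := hH
    have hY : ¬ hubY ends d p q ω := fun hY => by
      rcases conn_d_of_hubY hY with hc | hc
      · exact hpK (mem_KH_triple.2 (Or.inr (Or.inr hc)))
      · exact hqK (mem_KH_triple.2 (Or.inr (Or.inr hc)))
    have hW : ¬ hubW ends d p q ω := fun hW => by
      rcases conn_d_of_hubY hW with hc | hc
      · exact hpM (mem_MH_triple.2 (Or.inr (Or.inr hc)))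
      · exact hqM (mem_MH_triple.2 (Or.inr (Or.inr hc)))
    have hDW : ¬ deadW ends d r s ω := by
      rintro ⟨v, hvr, hvs, hvd, hvK, hc⟩
      refine hDZ v (by simp [hvr, hvs, hvd]) ?_ (mem_MH_triple.2 (Or.inr (Or.inr hc)))
      rcases mem_K2_iff.1 hvK with h | h
      · exact mem_KH_triple.2 (Or.inl h)
      · exact mem_KH_triple.2 (Or.inr (Or.inl h))
    have hDY : ¬ deadY ends d r s ω := by
      intro h
      obtain ⟨v, hvr, hvs, hvd, hvM, hc⟩ := deadY_iff.1 h
      refine hDZ v (by simp [hvr, hvs, hvd]) (mem_KH_triple.2 (Or.inr (Or.inr hc))) ?_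
      rcases mem_M2_iff.1 hvM with h' | h'
      · exact mem_MH_triple.2 (Or.inl h')
      · exact mem_MH_triple.2 (Or.inr (Or.inl h'))
    refine ⟨hsep, ?_, ?_, ?_⟩
    · intro v hvr hvs hvd hvK hvM
      refine hDZ v (by simp [hvr, hvs, hvd]) ?_ ?_
      · rcases mem_K2_iff.1 hvK with h | h
        · exact mem_KH_triple.2 (Or.inl h)
        · exact mem_KH_triple.2 (Or.inr (Or.inl h))
      · rcases mem_M2_iff.1 hvM with h | h
        · exact mem_MH_triple.2 (Or.inl h)
        · exact mem_MH_triple.2 (Or.inr (Or.inl h))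
    · rintro ⟨_, _, h | h⟩
      · exact hW h
      · exact hDW h
    · intro h
      obtain ⟨_, _, h | h⟩ := regB_iff.1 h
      · exact hY h
      · exact hDY h

/-- **`σ_rs` on the A-region**: with edges `d–r`, `d–s` and `d ∉ M₂`, both `T`-edges are `Y`, so
`r ~_Y s`, and `r ~_W s` avoids `d`: `σ_rs = 1 − 1[r ~_W s in G − d]`. -/
lemma sigma_rs_of_not_mem_M2 {r s d : V} {ω : Config E} (hM : d ∉ M2 ends r s ω) {er es : E}
    (her : ends er = s(d, r)) (hes : ends es = s(d, s)) :
    sigma ends ω r s = 1 - (if Conn (endsD ends d) (OneColourSwitch.compl ω) r s then 1 else 0) := by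
  have h1 := conn_of_edge_of_not_mem_M2 hM (Or.inl rfl) her
  have h2 := conn_of_edge_of_not_mem_M2 hM (Or.inr rfl) hes
  have hrs : Conn ends ω r s := conn_trans (conn_symm h1) h2
  have hrd : ¬ Conn ends (OneColourSwitch.compl ω) r d := fun h => hM (mem_M2_iff.2 (Or.inl h))
  have e : Conn ends (OneColourSwitch.compl ω) r s ↔
      Conn (endsD ends d) (OneColourSwitch.compl ω) r s :=
    ⟨fun h => conn_endsD_of_not_conn h hrd, conn_of_conn_endsD⟩
  simp only [sigma, hrs, if_true, e]

/-- **`σ_rs` on the B-region**: the mirror, `σ_rs = 1[r ~_Y s in G − d] − 1`. -/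
lemma sigma_rs_of_not_mem_K2 {r s d : V} {ω : Config E} (hK : d ∉ K2 ends r s ω) {er es : E}
    (her : ends er = s(d, r)) (hes : ends es = s(d, s)) :
    sigma ends ω r s = (if Conn (endsD ends d) ω r s then 1 else 0) - 1 := by
  have hM : d ∉ M2 ends r s (OneColourSwitch.compl ω) := by rwa [M2_compl]
  have := sigma_rs_of_not_mem_M2 hM her hes
  rw [sigma_compl', compl_compl] at this
  linarith

end Dead

section Sums

variable [Fintype E] [DecidableEq E]
variable (ends : E → Sym2 V)

/-- The A-region sum: `Σ_{Sep ∧ DOne ∧ regA ∧ r ≁_W s in G − d} σ̃_pq`. -/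
noncomputable def regionA (p q r s d : V) : ℤ :=
  ∑ ω : Config E, if sep2 ends p q r s ω ∧ DOne ends r s d ω ∧ regA ends p q r s d ω ∧
      ¬ Conn (endsD ends d) (OneColourSwitch.compl ω) r s then
    sigma (endsD ends d) ω p q else 0

/-- The B-region sum: `Σ_{Sep ∧ DOne ∧ regB ∧ r ≁_Y s in G − d} σ̃_pq`. -/
noncomputable def regionB (p q r s d : V) : ℤ :=
  ∑ ω : Config E, if sep2 ends p q r s ω ∧ DOne ends r s d ω ∧ regB ends p q r s d ω ∧
      ¬ Conn (endsD ends d) ω r s then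
    sigma (endsD ends d) ω p q else 0

variable {ends}

/-- **The dead-end partition of the `d`-avoiding sum**: with edges `d–r` and `d–s`,
`dSignSumAvoid = regionA − regionB + dzeroSignSumH {r, s, d}`. -/
theorem dSignSumAvoid_eq_dead (p q r s d : V) (hpd : p ≠ d) (hqd : q ≠ d) {er es : E}
    (her : ends er = s(d, r)) (hes : ends es = s(d, s)) :
    dSignSumAvoid ends p q r s d =
      regionA ends p q r s d - regionB ends p q r s d +
        dzeroSignSumH ends p q r s ({r, s, d} : Set V) := by
  unfold dSignSumAvoid regionA regionB dzeroSignSumH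
  rw [← Finset.sum_sub_distrib, ← Finset.sum_add_distrib]
  refine Finset.sum_congr rfl fun ω _ => ?_
  by_cases hsd : sep2 ends p q r s ω ∧ DOne ends r s d ω
  · obtain ⟨hsep, hD⟩ := hsd
    by_cases hA : regA ends p q r s d ω
    · have hB : ¬ regB ends p q r s d ω := fun hB => not_regA_and_regB her ⟨hA, hB⟩
      have hH : ¬ (sepH ends p q ({r, s, d} : Set V) ω ∧ DZeroH ends ({r, s, d} : Set V) ω) :=
        fun h => ((sep2_dOne_iff_sepH_dzeroH_of_not_reg hpd hqd her).2 h).2.2.1 hA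
      have hσ := sigma_rs_of_not_mem_M2 hA.1 her hes
      simp only [hsep, hD, hA, hB, hH, true_and, and_true, false_and,
        and_false, if_false, if_true, hσ]
      by_cases hc : Conn (endsD ends d) (OneColourSwitch.compl ω) r s <;> simp [hc]
    · by_cases hB : regB ends p q r s d ω
      · have hH : ¬ (sepH ends p q ({r, s, d} : Set V) ω ∧ DZeroH ends ({r, s, d} : Set V) ω) :=
          fun h => ((sep2_dOne_iff_sepH_dzeroH_of_not_reg hpd hqd her).2 h).2.2.2 hB
        have hσ := sigma_rs_of_not_mem_K2 (regB_iff.1 hB).1 her hes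
        simp only [hsep, hD, hA, hB, hH, true_and, and_true, false_and,
          and_false, if_false, if_true, hσ]
        by_cases hc : Conn (endsD ends d) ω r s <;> simp [hc]
      · have hH : sepH ends p q ({r, s, d} : Set V) ω ∧ DZeroH ends ({r, s, d} : Set V) ω :=
          (sep2_dOne_iff_sepH_dzeroH_of_not_reg hpd hqd her).1 ⟨hsep, hD, hA, hB⟩
        simp only [hsep, hD, hA, hB, hH, and_true, false_and,
          and_false, if_false, if_true, sigma_endsD_eq_of_sepH hH.1]
        ring
  · have h1 : ¬ (sep2 ends p q r s ω ∧ DOne ends r s d ω ∧ regA ends p q r s d ω ∧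
        ¬ Conn (endsD ends d) (OneColourSwitch.compl ω) r s) := fun h => hsd ⟨h.1, h.2.1⟩
    have h2 : ¬ (sep2 ends p q r s ω ∧ DOne ends r s d ω ∧ regB ends p q r s d ω ∧
        ¬ Conn (endsD ends d) ω r s) := fun h => hsd ⟨h.1, h.2.1⟩
    have h3 : ¬ (sepH ends p q ({r, s, d} : Set V) ω ∧ DZeroH ends ({r, s, d} : Set V) ω) :=
      fun h => hsd (by
        have := (sep2_dOne_iff_sepH_dzeroH_of_not_reg hpd hqd her).2 h
        exact ⟨this.1, this.2.1⟩)
    simp only [hsd, h1, h2, h3, if_false, sub_zero, add_zero]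

/-- **The B-region sum is the opposite of the A-region sum** (colour flip). -/
theorem regionB_eq_neg_regionA (p q r s d : V) :
    regionB ends p q r s d = - regionA ends p q r s d := by
  unfold regionB regionA
  rw [← Finset.sum_neg_distrib]
  rw [← sum_compl' (fun ω => if sep2 ends p q r s ω ∧ DOne ends r s d ω ∧ regB ends p q r s d ω ∧
      ¬ Conn (endsD ends d) ω r s then sigma (endsD ends d) ω p q else 0)]
  refine Finset.sum_congr rfl fun ω _ => ?_
  simp only [sep2_compl, DOne_compl_iff, regB_compl, sigma_compl']
  split_ifs <;> ring

/-- **`T1 = 2·regionA + dzeroSignSumH {r, s, d}`.** -/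
theorem dSignSumAvoid_eq_two_regionA (p q r s d : V) (hpd : p ≠ d) (hqd : q ≠ d) {er es : E}
    (her : ends er = s(d, r)) (hes : ends es = s(d, s)) :
    dSignSumAvoid ends p q r s d =
      2 * regionA ends p q r s d + dzeroSignSumH ends p q r s ({r, s, d} : Set V) := by
  rw [dSignSumAvoid_eq_dead p q r s d hpd hqd her hes, regionB_eq_neg_regionA]
  ring

end Sums

end NoPocket

end Summit.Ventures.PercRepro2
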